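import Summits.Ventures.LatticeQCDFlow.Scaling.HubChainStartContentCoverShallow

/-!
HONEST FRAMING: exact (Metropolis-corrected) sampling algorithms for lattice gauge theory; figures
of merit are autocorrelation/cost numbers at stated couplings and volumes; no continuum-physics
claim.

# HubChainStartContentCoverLabelled — CONJECTURE Σ FOR THE LABELLED STAR HUB CHAIN (`c = 1/K`, `K ≥ 2`): FOR EVERY `n` AND EVERY PAIR OF DISTINCT PARTICLES (START `z`,
# DEEPENED `s`), `P_Yⁿ(z,z) ≤ P_Xⁿ(z,z) + P_Xⁿ(z,s)` — NO SIDE CONDITION (lean-2 GEN-40, ours)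

Venture-side (OURS).  Cell `lqcd-flow` (pub-lqcd), unit `pub-lqcd-lean-2-g40`, 2026-08-30.  Chapter Z, file 9.  The labelled hub chain of chapter Y (files Y1∕Y2: `m = K+1` particles,
`P(i,j) = c·min{1,ρ_j/ρ_i}`, depth ranks, two sorted profiles agreeing off rank `s` with `ρ^X_s ≤ ρ^Y_s`) is the class chain with unit weights; with the star's `c(m−1) = 1` and
`m ≥ 3` the four typed cases cover EVERY pair: start deeper than `s` with `z ≥ 2` (Z6 `startClass_cover`), `(s,z) = (0,1)` (Z7 `startClass_cover_pair`), start shallower than `s`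
with `s ≥ 2` (Z2 `perStep_pow_diag_le`: no deficit at all), `(z,s) = (0,1)` (Z10 `startClass_cover_shallow`):

* **`startClass_cover_labelled`**: `z ≠ s`, both `< m`, `m ≥ 3`, `c(m−1) = 1` ⇒ `P_Yⁿ(z,z) ≤ P_Xⁿ(z,z) + P_Xⁿ(z,s)` for every `n`.

In words: deepening one particle raises the `n`-step return probability of any other particle by at most that particle's own `n`-step probability of sitting on the deepened one —
so for the star's `j`-attempt laws the start-content deficit is at most the tag occupation, `(y_j(z) − x_j(z))⁺ ≤ x_j(★)`, whenever the two tags are adjacent in depth (no particle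
strictly between).  Literature grade (cell rule): OWN; nothing cited; no new bib keys.
-/

open Finset

namespace Summit.Ventures.LatticeQCDFlow.Scaling

section CoverLabelled
variable {m s : ℕ} {ρX ρY RX RY βX βY : ℕ → ℝ} {c : ℝ} {PX PY fX fY : ℕ → ℕ → ℝ} {PnX PnY : ℕ → ℕ → ℕ → ℝ} {TX TY : ℕ → ℕ → ℝ}

/-- **CONJECTURE Σ, LABELLED CHAIN:** for `z ≠ s` (both `< m`, `m ≥ 3`, `c(m−1) = 1`): `P_Yⁿ(z,z) ≤ P_Xⁿ(z,z) + P_Xⁿ(z,s)` for every `n`. [ours] -/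
theorem startClass_cover_labelled (hρX : ∀ i, 0 < ρX i) (hmonoX : Monotone ρX) (hρY : ∀ i, 0 < ρY i) (hmonoY : Monotone ρY)
    (hagree : ∀ i, i ≠ s → ρX i = ρY i) (htag : ρX s ≤ ρY s)
    (hRX : ∀ k, RX k = ∑ i ∈ range k, ρX i) (hRY : ∀ k, RY k = ∑ i ∈ range k, ρY i)
    (hPXoff : ∀ i j, i ≠ j → PX i j = c * min 1 (ρX j / ρX i)) (hPXdiag : ∀ i, PX i i = 1 - ∑ j ∈ (range m).erase i, PX i j)
    (hPYoff : ∀ i j, i ≠ j → PY i j = c * min 1 (ρY j / ρY i)) (hPYdiag : ∀ i, PY i i = 1 - ∑ j ∈ (range m).erase i, PY i j)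
    (hfX : ∀ k i, fX k i = if i < k then ρX k else if i = k then -RX k else 0) (hfY : ∀ k i, fY k i = if i < k then ρY k else if i = k then -RY k else 0)
    (hβX : ∀ k, βX k = 1 - c * (((m - k : ℕ) : ℝ) + RX k / ρX k)) (hβY : ∀ k, βY k = 1 - c * (((m - k : ℕ) : ℝ) + RY k / ρY k))
    (hPX0 : ∀ i j, PnX 0 i j = if i = j then 1 else 0) (hPXs : ∀ n i j, PnX (n + 1) i j = ∑ l ∈ range m, PnX n i l * PX l j)
    (hPY0 : ∀ i j, PnY 0 i j = if i = j then 1 else 0) (hPYs : ∀ n i j, PnY (n + 1) i j = ∑ l ∈ range m, PnY n i l * PY l j)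
    (hTX : ∀ n j, TX n j = (1 - βX j ^ n) / RX m + ∑ k ∈ Ico (j + 1) m, (1 / RX k - 1 / RX (k + 1)) * (βX k ^ n - βX j ^ n))
    (hTY : ∀ n j, TY n j = (1 - βY j ^ n) / RY m + ∑ k ∈ Ico (j + 1) m, (1 / RY k - 1 / RY (k + 1)) * (βY k ^ n - βY j ^ n))
    (hc : 0 < c) (hcm : c * ((m : ℝ) - 1) = 1) (hm3 : 3 ≤ m) {z : ℕ} (hzs : z ≠ s) (hz : z < m) (hs : s < m) : ∀ n, PnY n z z ≤ PnX n z z + PnX n z s := by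
  -- the labelled data as class data with unit weights
  have hN : ∀ i : ℕ, (0 : ℝ) < (fun _ : ℕ => (1 : ℝ)) i := fun _ => one_pos
  have hN1 : ∀ i : ℕ, (1 : ℝ) ≤ (fun _ : ℕ => (1 : ℝ)) i := fun _ => le_rfl
  have hRX' : ∀ k, RX k = ∑ i ∈ range k, (fun _ : ℕ => (1 : ℝ)) i * ρX i := fun k => by rw [hRX k]; simp
  have hRY' : ∀ k, RY k = ∑ i ∈ range k, (fun _ : ℕ => (1 : ℝ)) i * ρY i := fun k => by rw [hRY k]; simp
  have hM : ∀ k, (fun k => ((m - k : ℕ) : ℝ)) k = ∑ i ∈ Ico k m, (fun _ : ℕ => (1 : ℝ)) i := fun k => sep_labelled_M m k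
  have hPXoff' : ∀ i j, i ≠ j → PX i j = c * (fun _ : ℕ => (1 : ℝ)) j * min 1 (ρX j / ρX i) := fun i j h => by rw [hPXoff i j h]; simp
  have hPYoff' : ∀ i j, i ≠ j → PY i j = c * (fun _ : ℕ => (1 : ℝ)) j * min 1 (ρY j / ρY i) := fun i j h => by rw [hPYoff i j h]; simp
  have hfX' : ∀ k i, fX k i = if i < k then ρX k else if i = k then -(RX k / (fun _ : ℕ => (1 : ℝ)) k) else 0 := fun k i => by rw [hfX]; simp
  have hfY' : ∀ k i, fY k i = if i < k then ρY k else if i = k then -(RY k / (fun _ : ℕ => (1 : ℝ)) k) else 0 := fun k i => by rw [hfY]; simp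
  have hβX' : ∀ k, βX k = 1 - c * ((fun k => ((m - k : ℕ) : ℝ)) k + RX k / ρX k) := fun k => by rw [hβX k]
  have hβY' : ∀ k, βY k = 1 - c * ((fun k => ((m - k : ℕ) : ℝ)) k + RY k / ρY k) := fun k => by rw [hβY k]
  obtain ⟨a, ha⟩ : ∃ a : ℕ → ℝ, ∀ l, a l = 1 - c * (fun k => ((m - k : ℕ) : ℝ)) (l + 1) := ⟨_, fun _ => rfl⟩
  have hm1 : 1 ≤ m := by omega
  have hM0 : (fun k => ((m - k : ℕ) : ℝ)) 0 = (m : ℝ) := by simp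
  have hcK : c * (fun k => ((m - k : ℕ) : ℝ)) 0 = 1 + c := by rw [hM0]; linarith
  have hPXnn : ∀ l, l < m → ∀ j, 0 ≤ PX l j := fun l hl j => cover_P_nonneg hρX hmonoX hN hN1 hRX' hM hPXoff' hPXdiag hβX' hc.le hcK.le hl j
  have hXnn := cover_pow_nonneg hPX0 hPXs hPXnn
  rcases Nat.lt_or_gt_of_ne hzs with hzs' | hsz
  · -- start shallower than the deepened particle
    rcases Nat.lt_or_ge s 2 with hs2 | hs2
    · -- `(z,s) = (0,1)`
      have hz0 : z = 0 := by omega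
      have hs1 : s = 1 := by omega
      subst hz0; subst hs1
      have h3 : (fun k => ((m - k : ℕ) : ℝ)) 3 + 3 ≤ (fun k => ((m - k : ℕ) : ℝ)) 0 := by
        show (((m - 3 : ℕ) : ℝ)) + 3 ≤ ((m - 0 : ℕ) : ℝ)
        rw [Nat.sub_zero, Nat.cast_sub hm3]; push_cast; linarith
      exact fun n => startClass_cover_shallow hρX hmonoX hρY hmonoY hagree htag hN hRX' hRY' hM hPXoff' hPXdiag hPYoff' hPYdiag hfX' hfY' hβX' hβY' ha hPX0 hPXs hPY0 hPYs
        hTX hTY hc hcK rfl rfl hs h3 n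
    · -- `s ≥ 2`: no deficit at all
      have h3 : (fun k => ((m - k : ℕ) : ℝ)) (s + 1) + 3 ≤ (fun k => ((m - k : ℕ) : ℝ)) 0 := by
        show (((m - (s + 1) : ℕ) : ℝ)) + 3 ≤ ((m - 0 : ℕ) : ℝ)
        rw [Nat.sub_zero, Nat.cast_sub (by omega)]; push_cast
        have : (2 : ℝ) ≤ (s : ℝ) := by exact_mod_cast hs2
        linarith
      intro n
      have h := perStep_pow_diag_le hρX hmonoX hρY hmonoY hagree htag hN hRX' hRY' hM hPXoff' hPXdiag hPYoff' hPYdiag hfX' hfY' hβX' hβY' ha hPX0 hPXs hPY0 hPYs hTX hTY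
        hc.le hcK.le n hzs' hs h3
      linarith [hXnn n z s]
  · -- start deeper than the deepened particle
    rcases Nat.lt_or_ge z 2 with hz2 | hz2
    · -- `(s,z) = (0,1)`
      have hz1 : z = 1 := by omega
      have hs0 : s = 0 := by omega
      subst hz1; subst hs0
      have h3 : (fun k => ((m - k : ℕ) : ℝ)) 3 + 3 ≤ (fun k => ((m - k : ℕ) : ℝ)) 0 := by
        show (((m - 3 : ℕ) : ℝ)) + 3 ≤ ((m - 0 : ℕ) : ℝ)
        rw [Nat.sub_zero, Nat.cast_sub hm3]; push_cast; linarith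
      exact startClass_cover_pair hρX hmonoX hρY hmonoY hagree htag hN hN1 hRX' hRY' hM hPXoff' hPXdiag hPYoff' hPYdiag hfX' hfY' hβX' hβY' ha hPX0 hPXs hPY0 hPYs hTX hTY
        hc hcK rfl rfl hz h3
    · have h3 : (fun k => ((m - k : ℕ) : ℝ)) (z + 1) + 3 ≤ (fun k => ((m - k : ℕ) : ℝ)) 0 := by
        show (((m - (z + 1) : ℕ) : ℝ)) + 3 ≤ ((m - 0 : ℕ) : ℝ)
        rw [Nat.sub_zero, Nat.cast_sub (by omega)]; push_cast
        have : (2 : ℝ) ≤ (z : ℝ) := by exact_mod_cast hz2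
        linarith
      exact startClass_cover hρX hmonoX hρY hmonoY hagree htag hN hN1 hRX' hRY' hM hPXoff' hPXdiag hPYoff' hPYdiag hfX' hfY' hβX' hβY' ha hPX0 hPXs hPY0 hPYs hTX hTY
        hc.le hcK.le hsz hz h3
end CoverLabelled

end Summit.Ventures.LatticeQCDFlow.Scaling
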